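import Summits.QuantumFields.YangMills.Theorems.UnitScaleTiltFluctuationComparisonRegPrGlobalSlackLegNaturalRowsTwoRunDoorPrint
import Summits.QuantumFields.YangMills.Theorems.UnitScaleTiltFluctuationComparisonRegPrGlobalSlackLegNaturalLipRows
import HarnessLib

/-!
# `UnitScaleTiltFluctuationComparisonRegPrGlobalSlackLegNaturalRowsTwoRunDoorPrintLip` — (B9): THE PRINT-SHAPED NATURAL-OBJECT DOOR OF 3⁗χ(v4) WITH (Lip♮) DISCHARGED — the fine
# distance FIXED to the bondwise sup, (BC) traded for (New) + (Fine_b) ONLY (crux `FluctuationComparisonRegPrIntL`, stmt-QuantumFields-20520, skeleton v5kD, STUB 3⁗χ(v4)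
# `stub_globalTwoRunSlackFamChiV4`; LEAD ym-ust-20520-w2 g5's (B9) «(B10) minus (Lip♮)», typed by ym-inputs-p12 gen 7 on the LEAD's word 2026-08-28 (order swap 14:16:37Z); count-neutral
# helper, def-free, registry untouched)

WHY.  LEAD ym-ust-20520-w2 g5's ✓`k1aLegRowsDisplayTwoRunChiAtV4_of_printRows` ((B10), `…NaturalRowsTwoRunDoorPrint`) gives the two-run display of 3⁗χ(v4) at the natural objects with a
run-coherent anchor from print-shaped letters (43), (K_b), (K₀), (ℓ), (k₀) and a fine distance `δ` of the supplier's choosing with (New), (Lip♮), (Fine_b).  ym-inputs-p12 g7's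
✓`lipNaturalSel_chiV4_of_le_gammaθ` (`…LegNaturalLipRows`, on the record-free core `…LegNaturalLipCore`) PROVES (Lip♮) at `δ :=` the bondwise sup distance `⨆_e ‖U(e) − U′(e)‖`,
`L_Φ := 256·L`, below the coupling threshold `gammaθ b₀ p₁ σ_Lip` — from the record's minimiser rows, [Balaban1985Averaging] Prop. 2 and the two-field averaging theorem, WITHOUT (Fine_b).
THIS FILE is the one-step composition: (B10) with `L_Φ := 256·L`, `δ :=` the bondwise sup, `γB` shrunk to `min γB (gammaθ b₀ p₁ σ_Lip)`, the `∃ δ` slot and the (Lip♮) conjunct GONE.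

WHAT THIS FILE PROVES (def-free).
* ★★★★★ **`k1aLegRowsDisplayTwoRunChiAtV4_of_printRows_lip`** (`1 < L < 𝔠.M₁`, `p₁ ≥ p₀ + r₀`, `sel F K b Y ∈ anchors K b Y` run-coherent): `K1aLegRowsDisplayTwoRunChiAtV4 L 𝔠 a₀ a₁ a p₁` ⇐
  ∃ `κ′ < κ₁`, `R`, `C₀ A₁ A ≥ 0`, `b ≥ 2, ≥ a+1`, `C_f ≥ 0`, `C_N`, `γB > 0`, ∀ F γ ≤ γB, `OfV4ChiAt` → ∃ p coherent, ∃ N: (43) · (K_b) · (K₀) · (ℓ) · (k₀) · (New) ·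
  (Fine_b)[`⨆_e ‖U_K(e) − (e₀ avg₀ U_{K+1})(e)‖ ≤ C_f·θ_{b₀,p₁}(n)·(L^{−(K−n)})^b`].  So at the natural objects the DECIDING crux's display residue (modulo T8, 2′χ(v4), `1 < L < M₁`) reads,
  letter for letter: (43)-as-definition, (K_b), (ℓ), (k₀), (New) — print-shaped record/definer rows — and THE TWO UNPRINTED two-cut-off estimates of non-abelian `d = 3`: (K₀) (kernels)
  and (Fine_b) (fine backgrounds, now in ONE fixed currency: the bondwise sup on run `K`'s finest lattice).  (Lip♮) is no longer displayed anywhere.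
HONEST SCOPE.  A composition of two landed theorems; (43), (K_b), (K₀), (ℓ), (k₀), (New), (Fine_b) are HYPOTHESES, not asserted; nothing of [Balaban1985UV3] / [Balaban1985Averaging] /
[King1986] is asserted; no stub / crux / registry object touched (`--supports stmt-QuantumFields-20520`); no summit / rung / gap claim (YM₃ on T³ is ladder rung R3, not the Clay problem).
L-floor: none beyond `1 < L`; `L < M₁` is print's big-block letter.

References: T. Bałaban, CMP 102 (1985) 255–275 [Balaban1985UV3] (p.263 L4, (24)–(25) p.262, (27)–(30) p.263, (33)–(34) p.264, (43)–(45) pp.266–267, (59)–(63) pp.270–272); CMP 98 (1985)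
17–51 [Balaban1985Averaging] (Prop. 2 (54) p.26, Prop. 6 (164) p.43); C. King, CMP 102 (1986) 649–677 [King1986] (Prop. 3.6 (3.56) p.662, Prop. 3.9 (3.71)–(3.74) p.665); CMP 109 (1987)
249–301 [Balaban1987RG1] ((0.1) p.251, (0.11) p.253).
-/

set_option autoImplicit false

noncomputable section

open scoped Matrix.Norms.L2Operator Nat
open Literature.MathematicalPhysics.QuantumFieldTheory.Balaban1983to89
open Literature.MathematicalPhysics.QuantumFieldTheory.Balaban1983to89.T3ContinuumYM3Torus
open Literature.MathematicalPhysics.QuantumFieldTheory.Balaban1983to89.T3UnitLawDensityEML (ℰp)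
open Literature.MathematicalPhysics.QuantumFieldTheory.Balaban1983to89.T3UnitScaleTilt (θBal)
open Literature.MathematicalPhysics.QuantumFieldTheory.Balaban1983to89.T3LevelShift (fieldShift)
open Literature.MathematicalPhysics.QuantumFieldTheory.Balaban1983to89.T3AlphaInputsAC (AlphaDataT3)
open Literature.MathematicalPhysics.QuantumFieldTheory.Balaban1983to89.T3AlphaPolymerSocket (refineSet)
open Literature.MathematicalPhysics.QuantumFieldTheory.Balaban1983to89.TreeLengthTorus (tsys)
open Literature.MathematicalPhysics.QuantumFieldTheory.Balaban1983to89.B10Eq27TorusAxialLog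
open Literature.MathematicalPhysics.QuantumFieldTheory.Balaban1983to89.B7Prop1Explicit (l1)
open Literature.MathematicalPhysics.QuantumFieldTheory.Balaban1983to89.ExpMeanLog (deltaSU deltaSU_pos)
open Literature.MathematicalPhysics.QuantumFieldTheory.Balaban1985CMP102
open Literature.MathematicalPhysics.QuantumFieldTheory.Balaban1985CMP102.Setting
open Literature.MathematicalPhysics.QuantumFieldTheory.Balaban1985CMP102.Binders (ChartAnalyticityAsCited)
open Summit.QuantumFields.Balaban3D.Carriers
open Summit.QuantumFields.Balaban3D.Proofs.Primitives
open Summit.QuantumFields.Balaban3D.Proofs.GroupModelLieC (vecE lieC)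
open Summit.QuantumFields.YangMills.Theorems
open Summit.QuantumFields.YangMills.Theorems.GlobalSlackKernelMatching
open Summit.QuantumFields.YangMills.Theorems.GlobalSlackCanonicalPolymers

namespace Summit.QuantumFields.YangMills.Theorems.GlobalSlackKernelLeg

variable (sel : (F : T3Family) → (K b : ℕ) → Set (Site (F.P K) 0) → Site (F.P K) b)
  (hsel : ∀ (F : T3Family) (K b : ℕ) (Y : Set (Site (F.P K) 0)), sel F K b Y ∈ anchors K b Y)

include hsel

/-! ## (B9) The print-shaped door at a run-coherent anchor, (Lip♮) discharged -/

open Classical in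
/-- ★★★★★ **THE TWO-RUN DISPLAY OF 3⁗χ(v4) AT THE NATURAL OBJECTS, EVERY LETTER PRINT-SHAPED, (Lip♮) DISCHARGED** — LEAD's (B10) ✓`k1aLegRowsDisplayTwoRunChiAtV4_of_printRows` with its
(Lip♮) conjunct supplied by ✓`lipNaturalSel_chiV4_of_le_gammaθ` (`L_Φ := 256·L`, `δ :=` the bondwise sup distance on run `K`'s finest lattice, coupling threshold shrunk to
`min γB (gammaθ b₀ p₁ σ_Lip)`, `σ_Lip = min a₁ (min (a₀/B₃) (min (1/(3·143·(7²/4)²·B₃)) (min (δ_{SU(2)}/((7L)²·B₃)) (1/(8·10¹⁴·B₃)))))`).  Displayed letters: (43) the record's old terms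
ARE the kernel polynomials at `B♮[sel]`; (K_b) the birth charts' two-run kernel row off the blocks; (K₀) the kernels of runs `K`, `K+1` agree ([King1986] Prop. 3.6's shape; UNPRINTED
for non-abelian `d = 3`); (ℓ) locality; (k₀) print's pointwise (43) decay; (New) the record's `Bcfg` across the two runs at the new chart level; (Fine_b)
`⨆_e ‖U_K(e) − (e₀ avg₀ U_{K+1})(e)‖ ≤ C_f·θ_{b₀,p₁}(n)·(L^{−(K−n)})^b` ([King1986] Prop. 3.9's shape; UNPRINTED).  THEN `K1aLegRowsDisplayTwoRunChiAtV4 L 𝔠 a₀ a₁ a p₁`.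
[cite: Balaban1985UV3, p.263 L4, (24)-(25) p.262, (27)-(30) p.263, (33)-(34) p.264, (43)-(45) pp.266-267, (59)-(63) pp.270-272; Balaban1985Averaging, Prop. 2 (54) p.26, Prop. 6 (164) p.43; King1986, Prop. 3.6 (3.56) p.662, Prop. 3.9 (3.71)-(3.74) p.665; Balaban1987RG1, (0.1) p.251, (0.11) p.253] -/
theorem k1aLegRowsDisplayTwoRunChiAtV4_of_printRows_lip {L : ℕ} (hL : 1 < L) {𝔠 : AlphaConsts L (suGroupModel 2).N} (hM : L < 𝔠.M₁) {a₀ a₁ a p₁ : ℝ}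
    (ha₀ : 0 < a₀) (ha₁ : 0 < a₁) (hp₁ : 𝔠.p₀ + 𝔠.r₀ ≤ p₁)
    (hcoh : ∀ (F : T3Family) (K b : ℕ) (Y : Set (Site (F.P K) 0)), sel F (K + 1) (b + 1) (refineSet F K Y) = liftSite F K b (sel F K b Y))
    (h : ∃ (κ' κ₁ R C₀ A₁ A b C_f C_N γB : ℝ), 0 < κ' ∧ κ' < κ₁ ∧ 0 ≤ C₀ ∧ 0 ≤ A₁ ∧ 0 ≤ A ∧ 2 ≤ b ∧ a + 1 ≤ b ∧ 0 ≤ C_f ∧ 0 < γB ∧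
      ∀ (F : T3Family) (γ : ℝ) (hF : F.L = L) (hγ : 0 < γ), γ ≤ γB → ∀ (hγ1 : γ ≤ (min (hF ▸ 𝔠).gamma0 1) ^ 2),
        AlphaInputsT3AC.OfV4ChiAt F (hF ▸ 𝔠) a₀ a₁ →
          ∃ (p : ∀ K, AlphaInputsT3AC.PkgAtV4Chi F (hF ▸ 𝔠) γ hγ hγ1 K), (∀ K, (p K).a₀ = a₀ ∧ (p K).a₁ = a₁) ∧
            ∃ (N : (K b : ℕ) → Site (F.P K) (1 + b) → (n : ℕ) → (Fin n → PBond (F.P K) b) →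
                ContinuousMultilinearMap ℂ (fun _ : Fin n => ↥(lieC (suGroupModel 2))) ℂ),
              (∀ (K k : ℕ), k + 1 ≤ K → ∀ j : ℕ, j < k →
                ∀ y ∈ oldBlocks (hF ▸ 𝔠).lane.carrier.M₁ (rcolOf (SK F (hF ▸ 𝔠) γ hγ hγ1 K) (hF ▸ 𝔠).lane.carrier) (Hist.triv (F.P K) (k + 1)) (1 + j),
                  ∀ W : GaugeField (F.P K) (k + 1) (Matrix.specialUnitaryGroup (Fin 2) ℂ),
                    oldTermRows (fun K => (p K).toRows) K k (1 + j) y W =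
                      (∑ n ∈ Finset.Ico 2 7, ((n ! : ℂ))⁻¹ * ∑ c : Fin n → PBond (F.P K) j, N K j y n c (fun i =>
                        (fun K k b Y W c =>
                          if h : b + 1 = k then birthCfgAtRows (fun K => (p K).toRows) K b Y (h ▸ W) c
                          else if (l1 (rel (sel F K b Y) c.src) : ℝ) *
                              (2 * ((hF ▸ 𝔠).B₃ * θBal F.L γ (hF ▸ 𝔠).b₀ p₁ (K - k)) * (((F.L : ℝ) ^ (k - b))⁻¹) ^ 2) ≤ 1 / 2 then
                            (lieC (suGroupModel 2)).orthogonalProjectionOnto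
                              (vecE (suGroupModel 2).N
                                (B27T (unitsField (toUField (Averaging.iter (fun i => BlockAveraging.blockAvg (P := F.P K) (j := i) ℰp) b
                                  ((p K).UkH k (Hist.triv (F.P K) k) W)))) (sel F K b Y) c))
                          else 0) K (k + 1) j (blockSet K (1 + j) y) W (c i))).re) ∧
              -- (K_b) the two-run kernel row of the BIRTH charts off the blocks (record level)
              (∀ (K k b : ℕ) (Y : Set (Site (F.P K) 0)), Y ∈ canonLocRows (fun K => (p K).toRows) K k (Hist.triv (F.P K) k) (1 + b) →
                (∀ y : Site (F.P K) (1 + b), blockSet K (1 + b) y ≠ Y) → ∀ d ∈ Finset.Ico 2 7,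
                  ‖(kerT (birthChartRows fun K => (p K).toRows) K b Y d - ker (birthChartRows fun K => (p K).toRows) K b Y d).compContinuousLinearMap
                      fun _ => legL ↥(lieC (suGroupModel 2)) (canonLegDist F) κ' K b Y‖ ≤
                    C₀ * Real.exp (-(hF ▸ 𝔠).κ * (AlphaInputsT3AC.dataOfV4chi p (canonPolymerRows fun K => (p K).toRows)).treeLen K (1 + b) Y) *
                      (((F.L : ℝ) ^ (1 + b))⁻¹) ^ a) ∧
              -- (K₀) print's KERNELS ACROSS THE TWO CUT-OFFS, pointwise ([King1986] Prop. 3.6's shape) — UNPRINTED for non-abelian d = 3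
              (∀ (K k b : ℕ) (y : Site (F.P K) (1 + b)), blockSet K (1 + b) y ∈ canonLocRows (fun K => (p K).toRows) K k (Hist.triv (F.P K) k) (1 + b) →
                ∀ n ∈ Finset.Ico 2 7, ∀ c : Fin n → PBond (F.P K) b,
                  ‖N (K + 1) (b + 1) (liftSite F K (1 + b) y) n (fun i => matchBond F K b (c i)) - N K b y n c‖ ≤
                    A₁ * (∏ i, Real.exp (-(κ₁ * canonLegDist F K b (blockSet K (1 + b) y) (c i)))) * (((F.L : ℝ) ^ (1 + b))⁻¹) ^ a) ∧
              -- (ℓ) locality of the retained charts at leg distance `R`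
              (∀ (K b : ℕ), b + 1 ≤ K → ∀ X ∈ newDomsRows (fun K => (p K).toRows) K b (Hist.triv (F.P K) (b + 1)),
                ∀ z : PBond (F.P K) b → ↥(lieC (suGroupModel 2)),
                  (((p K).toRows).𝔖 b).Ψ X z =
                    (((p K).toRows).𝔖 b).Ψ X (fun c => if canonLegDist F K b (domSet (F := F) (hF ▸ 𝔠).lane.carrier.M₁ K b X) c ≤ R then z c else 0) ∧
                  (((p K).toRows).𝔄.Λc b).Ψ X z =
                    (((p K).toRows).𝔄.Λc b).Ψ X (fun c => if canonLegDist F K b (domSet (F := F) (hF ▸ 𝔠).lane.carrier.M₁ K b X) c ≤ R then z c else 0)) ∧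
              -- (k₀) print's POINTWISE (43) decay of the kernels at the listed blocks, rate `κ₁ > κ′`
              (∀ (K k b : ℕ) (y : Site (F.P K) (1 + b)),
                blockSet K (1 + b) y ∈ canonLocRows (fun K => (p K).toRows) K k (Hist.triv (F.P K) k) (1 + b) →
                  ∀ n ∈ Finset.Ico 2 7, ∀ c : Fin n → PBond (F.P K) b,
                    ‖N K b y n c‖ ≤ A * ∏ i, Real.exp (-(κ₁ * canonLegDist F K b (blockSet K (1 + b) y) (c i)))) ∧
              -- (New) the two-run row at the NEW chart level only (both sides are the record's `Bcfg`: B0's coherence)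
              (∀ (K n : ℕ) (h : n ≤ K), ∀ j : ℕ, j < K - n → j + 1 = K - n → ∀ V : GaugeField (F.P n) 0 (Matrix.specialUnitaryGroup (Fin 2) ℂ), PlaqSmall (θBal F.L γ (hF ▸ 𝔠).b₀ p₁ n) V →
        ∀ Y ∈ (AlphaInputsT3AC.dataOfV4chi p (canonPolymerRows fun K => (p K).toRows)).Loc K (K - n)
          ((AlphaInputsT3AC.dataOfV4chi p (canonPolymerRows fun K => (p K).toRows)).triv K (K - n)) (1 + j), ∀ c : PBond (F.P K) j,
          ‖(fun K k b Y W c =>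
        if h : b + 1 = k then birthCfgAtRows (fun K => (p K).toRows) K b Y (h ▸ W) c
        else if (l1 (rel (sel F K b Y) c.src) : ℝ) * (2 * ((hF ▸ 𝔠).B₃ * θBal F.L γ (hF ▸ 𝔠).b₀ p₁ (K - k)) * (((F.L : ℝ) ^ (k - b))⁻¹) ^ 2) ≤ 1 / 2 then
          (lieC (suGroupModel 2)).orthogonalProjectionOnto (vecE (suGroupModel 2).N (B27T (unitsField (toUField
            (Averaging.iter (fun i => BlockAveraging.blockAvg (P := F.P K) (j := i) ℰp) b ((p K).UkH k (Hist.triv (F.P K) k) W)))) (sel F K b Y) c))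
        else 0) (K + 1) (K + 1 - n) (j + 1) (refineSet F K Y)
                (fieldShift (F.sitesPerDir_eq (m := F.m) (K := K + 1) (j := K + 1 - n) (m' := F.m) (K' := n) (j' := 0) (by omega)) V) (matchBond F K j c) -
              (fun K k b Y W c =>
        if h : b + 1 = k then birthCfgAtRows (fun K => (p K).toRows) K b Y (h ▸ W) c
        else if (l1 (rel (sel F K b Y) c.src) : ℝ) * (2 * ((hF ▸ 𝔠).B₃ * θBal F.L γ (hF ▸ 𝔠).b₀ p₁ (K - k)) * (((F.L : ℝ) ^ (k - b))⁻¹) ^ 2) ≤ 1 / 2 then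
          (lieC (suGroupModel 2)).orthogonalProjectionOnto (vecE (suGroupModel 2).N (B27T (unitsField (toUField
            (Averaging.iter (fun i => BlockAveraging.blockAvg (P := F.P K) (j := i) ℰp) b ((p K).UkH k (Hist.triv (F.P K) k) W)))) (sel F K b Y) c))
        else 0) K (K - n) j Y
                (fieldShift (F.sitesPerDir_eq (m := F.m) (K := K) (j := K - n) (m' := F.m) (K' := n) (j' := 0) (by omega)) V) c‖ ≤
            C_N * (1 + canonLegDist F K j Y c) * θBal F.L γ (hF ▸ 𝔠).b₀ p₁ n * (((F.L : ℝ) ^ (K - n - 1 - j))⁻¹) ^ 2 * (((F.L : ℝ) ^ (1 + j))⁻¹) ^ a) ∧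
              -- (Fine_b) the two fine backgrounds of runs `K`, `K+1` are close in the BONDWISE SUP distance on run `K`'s finest lattice
              (∀ (K n : ℕ) (h : n ≤ K), 1 < K - n → ∀ V : GaugeField (F.P n) 0 (Matrix.specialUnitaryGroup (Fin 2) ℂ), PlaqSmall (θBal F.L γ (hF ▸ 𝔠).b₀ p₁ n) V →
        (⨆ e' : PBond (F.P K) 0, ‖(((p K).UkH (K - n) (Hist.triv (F.P K) (K - n)) (fieldShift (F.sitesPerDir_eq (m := F.m) (K := K) (j := K - n) (m' := F.m) (K' := n) (j' := 0) (by omega)) V) e' : Matrix.specialUnitaryGroup (Fin 2) ℂ) : Matrix (Fin 2) (Fin 2) ℂ) -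
            ((fieldShift (F.sitesPerDir_eq (m := F.m) (K := K) (j := 0) (m' := F.m) (K' := K + 1) (j' := 1) (by omega)) ((BlockAveraging.blockAvg (P := F.P (K + 1)) (j := 0) ℰp).avg
                ((p (K + 1)).UkH (K + 1 - n) (Hist.triv (F.P (K + 1)) (K + 1 - n)) (fieldShift (F.sitesPerDir_eq (m := F.m) (K := K + 1) (j := K + 1 - n) (m' := F.m) (K' := n) (j' := 0) (by omega)) V))) e' : Matrix.specialUnitaryGroup (Fin 2) ℂ) : Matrix (Fin 2) (Fin 2) ℂ)‖) ≤
          C_f * θBal F.L γ (hF ▸ 𝔠).b₀ p₁ n * (((F.L : ℝ) ^ (K - n))⁻¹) ^ b)) :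
    K1aLegRowsDisplayTwoRunChiAtV4 L 𝔠 a₀ a₁ a p₁ := by

  obtain ⟨κ', κ₁, R, C₀, A₁, A, b, C_f, C_N, γB, hκ', hκ₁, hC₀, hA₁, hA, hb2, hab, hCf, hγB, hall⟩ := h
  have hp₁' : 0 < p₁ := by have := 𝔠.p₀_pos; have := 𝔠.one_le_r₀; linarith
  have hB : 0 < 𝔠.B₃ := 𝔠.B₃_pos
  have hδ : 0 < deltaSU (Fin 2) := deltaSU_pos
  have hσ : 0 < (min a₁ (min (a₀ / 𝔠.B₃) (min (1 / (3 * (143 * ((((3 + 4 : ℕ) : ℝ)) ^ 2 / 4) ^ 2) * 𝔠.B₃))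
      (min (deltaSU (Fin 2) / ((((3 + 4) * L : ℕ) : ℝ) ^ 2 * 𝔠.B₃)) (1 / (8 * 10 ^ 14 * 𝔠.B₃)))))) := by
    have hL0 : 0 < L := by omega
    have : (0 : ℝ) < (((3 + 4) * L : ℕ) : ℝ) ^ 2 := by positivity
    positivity
  have hγθ := gammaθ_pos 𝔠.b₀_pos hp₁' hσ
  refine k1aLegRowsDisplayTwoRunChiAtV4_of_printRows sel hsel hL hM ha₀ ha₁ hp₁ hcoh
    ⟨κ', κ₁, R, C₀, A₁, A, b, 256 * (L : ℝ), C_f, C_N, min γB (gammaθ 𝔠.b₀ p₁ (min a₁ (min (a₀ / 𝔠.B₃) (min (1 / (3 * (143 * ((((3 + 4 : ℕ) : ℝ)) ^ 2 / 4) ^ 2) * 𝔠.B₃))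
      (min (deltaSU (Fin 2) / ((((3 + 4) * L : ℕ) : ℝ) ^ 2 * 𝔠.B₃)) (1 / (8 * 10 ^ 14 * 𝔠.B₃))))))),
      hκ', hκ₁, hC₀, hA₁, hA, hb2, hab, by positivity, hCf, lt_min hγB hγθ, fun F γ hF hγ hγle hγ1 hOf => ?_⟩
  obtain ⟨p, hp, N, h43, hKb, hK0, hloc, hpt, hNew, hFine⟩ := hall F γ hF hγ (hγle.trans (min_le_left _ _)) hγ1 hOf
  have hγw := hγle.trans (min_le_right _ _)
  subst hF
  exact ⟨p, hp, N, h43, hKb, hK0, hloc, hpt,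
    fun K _ U U' => ⨆ e' : PBond (F.P K) 0, ‖((U e' : Matrix.specialUnitaryGroup (Fin 2) ℂ) : Matrix (Fin 2) (Fin 2) ℂ) -
      ((U' e' : Matrix.specialUnitaryGroup (Fin 2) ℂ) : Matrix (Fin 2) (Fin 2) ℂ)‖,
    hNew, lipNaturalSel_chiV4_of_le_gammaθ p ha₀ ha₁ hp hp₁' (sel F) (hsel F) hγw, hFine⟩

end Summit.QuantumFields.YangMills.Theorems.GlobalSlackKernelLeg

end
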